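import Summits.QuantumFields.YangMills.Theorems.ConvexGribovBodyNonSimplyConnectedLatticeGapStubTiltSchwarzSpatial
import HarnessLib

/-!
# Crux `NonSimplyConnectedLatticeGap` (stmt-QuantumFields-16405), line `Sketch`:
# stub (SCHWARZ-TEMPORAL) `stub_tiltSchwarz_temporal` — the reflection Schwarz inequality for the
# tilt functionals of a temporal orientation class on the odd four-torus

For the tilt functionals `Ψ(c) := E_β exp(-∑ₓ c(x) Re tr ρ(U_{(x,o)}))` of a fixed TEMPORAL plane
`o` (`o.1.1 = 0`) on the odd torus `(ℤ/(2S+1))⁴`, `S ≥ 1`, and every profile `0 ≤ e ≤ β` we prove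
`Ψ(e)² ≤ Ψ(e⁻) Ψ(e⁺)`, where, for the reflection `r x = x[0 := -x₀]` of base sites (the site part
`θ(x + e₀)` of `WilsonRP.plaqReflect (x, o)` for a temporal plane; fixed layer `x₀ = 0`, the
crossing layer of temporal plaquettes straddling the bond hyperplane), `e⁺` keeps the layers
`0 ≤ x₀ ≤ S` (`(x₀ - 0).val ≤ S`) and is `e ∘ r` elsewhere, and `e⁻` keeps the layers
`x₀ ∈ {0} ∪ [S + 1, 2S]` (`(0 - x₀).val ≤ S`).

Route: the landed reflection Schwarz inequality `schwarz_profiles` of crux `LatticeGapOnTrajectory`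
(odd-torus Osterwalder–Seiler positivity with a crossing tilt, its hypothesis (A) being the landed
`stub_oddRPCrossTilt`), `Ψ(eQ ∘ r + eP + w)² ≤ Ψ(eP ∘ r + eP + w) Ψ(eQ ∘ r + eQ + w)`, applied with
the crossing profile `w = e` on the crossing layer `x₀ = 0` (`0` elsewhere; admissible since
`0 ≤ e ≤ β`) and the half profiles `eP = e`, `eQ = e ∘ r` on the layers `[1, S]` (`0` elsewhere);
the three combined profiles are pointwise `e`, `e⁺`, `e⁻` (layer bookkeeping on the odd cycle).
-/

set_option autoImplicit false

namespace Summit.QuantumFields.YangMills.Theorems.NonSimplyConnectedLatticeGap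

open scoped BigOperators
open MeasureTheory Literature.MathematicalPhysics.QuantumFieldTheory
open Summit.QuantumFields.YangMills.Cruxes.LatticeGapOnTrajectory.SparseDefectOrbitWindow

/-! ## The site reflection of a temporal class -/

/-- For a temporal plane the site part of the plaquette reflection is `x ↦ θ(x + e₀)`. -/
theorem tiltSchwarzTemporal_plaqReflect_fst {S : ℕ} (o : {q : Fin 4 × Fin 4 // q.1 < q.2})
    (ho : o.1.1 = 0) (x : Site 4 (2 * S + 1)) :
    (WilsonRP.plaqReflect (x, o)).1 = (x.shift 0).timeReflect := by
  simp [WilsonRP.plaqReflect, ho]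

/-- The reflection written about the fixed layer `0`: `x[0 := 2 ⬝ 0 - x₀] = θ(x + e₀)`. -/
theorem tiltSchwarzTemporal_update_eq {S : ℕ} (x : Site 4 (2 * S + 1)) :
    Function.update x 0 (2 * (0 : ZMod (2 * S + 1)) - x 0) = (x.shift 0).timeReflect := by
  funext k
  by_cases hk : k = 0
  · subst hk
    rw [Function.update_self, WilsonRP.timeReflect_apply_zero, WilsonRP.shift_apply_self]
    ring
  · rw [Function.update_of_ne hk, WilsonRP.timeReflect_apply_of_ne _ hk,
      WilsonRP.shift_apply_of_ne _ hk]

/-- The time coordinate of the reflected site is `0 - x₀`. -/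
theorem tiltSchwarzTemporal_zero_sub {S : ℕ} (x : Site 4 (2 * S + 1)) :
    (0 : ZMod (2 * S + 1)) - x 0 = (x.shift 0).timeReflect 0 := by
  rw [WilsonRP.timeReflect_apply_zero, WilsonRP.shift_apply_self]
  ring

/-- **Layer trichotomy.** A site lies on the crossing layer `x₀ = 0` (fixed by the reflection of
layers), or in the kept half `1 ≤ x₀ ≤ S` (and then its reflection lies in neither), or in the
complement `S + 1 ≤ x₀ ≤ 2S` (and then its reflection lies in the kept half). -/
theorem tiltSchwarzTemporal_layers {S : ℕ} (x : Site 4 (2 * S + 1)) :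
    ((x 0).val = 0 ∧ ((x.shift 0).timeReflect 0).val = 0) ∨
      (1 ≤ (x 0).val ∧ (x 0).val ≤ S ∧
        ¬(1 ≤ ((x.shift 0).timeReflect 0).val ∧ ((x.shift 0).timeReflect 0).val ≤ S) ∧
        ((x.shift 0).timeReflect 0).val ≠ 0) ∨
      (¬(1 ≤ (x 0).val ∧ (x 0).val ≤ S) ∧ (x 0).val ≠ 0 ∧
        1 ≤ ((x.shift 0).timeReflect 0).val ∧ ((x.shift 0).timeReflect 0).val ≤ S) := by
  have hv := ZMod.val_lt (x 0)
  have hy := WilsonRP.val_timeReflect_shift_zero x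
  by_cases h0 : (x 0).val = 0
  · rw [if_pos h0] at hy
    exact Or.inl ⟨h0, hy⟩
  · rw [if_neg h0] at hy
    by_cases ha : 1 ≤ (x 0).val ∧ (x 0).val ≤ S
    · exact Or.inr (Or.inl ⟨ha.1, ha.2, by omega, by omega⟩)
    · exact Or.inr (Or.inr ⟨ha, h0, by omega, by omega⟩)

/-! ## The half profiles, the crossing profile and the three combined profiles -/

/-- The half profiles live on the kept layers `1 ≤ x₀ ≤ S`. -/
theorem tiltSchwarzTemporal_support {S : ℕ} (o : {q : Fin 4 × Fin 4 // q.1 < q.2})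
    (f g : Site 4 (2 * S + 1) → ℝ)
    (hf : ∀ x, f x = if 1 ≤ (x 0).val ∧ (x 0).val ≤ S then g x else 0)
    (x : Site 4 (2 * S + 1)) (hx : f x ≠ 0) :
    (1 ≤ (x 0).val ∧ (x 0).val ≤ S) ∨ (o.1.1 ≠ 0 ∧ (x 0).val = S + 1) := by
  rw [hf] at hx
  by_cases ha : 1 ≤ (x 0).val ∧ (x 0).val ≤ S
  · exact Or.inl ha
  · exact absurd (if_neg ha) hx

/-- The crossing profile lives on crossing plaquettes (temporal plane, base layer `0`). -/
theorem tiltSchwarzTemporal_support_cross {S : ℕ} (o : {q : Fin 4 × Fin 4 // q.1 < q.2})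
    (ho : o.1.1 = 0) (e w : Site 4 (2 * S + 1) → ℝ)
    (hw : ∀ x, w x = if (x 0).val = 0 then e x else 0)
    (x : Site 4 (2 * S + 1)) (hx : w x ≠ 0) : WilsonOddRP.IsOCrossPlaq (x, o) := by
  rw [hw] at hx
  by_cases h0 : (x 0).val = 0
  · exact ⟨ho, h0⟩
  · exact absurd (if_neg h0) hx

section Profiles

variable {S : ℕ} (o : {q : Fin 4 × Fin 4 // q.1 < q.2}) (ho : o.1.1 = 0)
  (e eP eQ w : Site 4 (2 * S + 1) → ℝ)
  (hP : ∀ x, eP x = if 1 ≤ (x 0).val ∧ (x 0).val ≤ S then e x else 0)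
  (hQ : ∀ x, eQ x = if 1 ≤ (x 0).val ∧ (x 0).val ≤ S then e (x.shift 0).timeReflect else 0)
  (hw : ∀ x, w x = if (x 0).val = 0 then e x else 0)

include ho hP hQ hw

omit hQ hw in
/-- `eP ∘ r` vanishes off the complement `S + 1 ≤ x₀`, where it is `e ∘ r`. -/
theorem tiltSchwarzTemporal_eP_reflect (x : Site 4 (2 * S + 1)) :
    eP (WilsonRP.plaqReflect (x, o)).1 =
      if 1 ≤ ((x.shift 0).timeReflect 0).val ∧ ((x.shift 0).timeReflect 0).val ≤ S
      then e (x.shift 0).timeReflect else 0 := by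
  rw [tiltSchwarzTemporal_plaqReflect_fst o ho, hP]

omit hP hw in
/-- `eQ ∘ r` vanishes off the complement `S + 1 ≤ x₀`, where it is `e`. -/
theorem tiltSchwarzTemporal_eQ_reflect (x : Site 4 (2 * S + 1)) :
    eQ (WilsonRP.plaqReflect (x, o)).1 =
      if 1 ≤ ((x.shift 0).timeReflect 0).val ∧ ((x.shift 0).timeReflect 0).val ≤ S
      then e x else 0 := by
  rw [tiltSchwarzTemporal_plaqReflect_fst o ho, hQ, WilsonRP.timeReflect_shift_timeReflect_shift]

omit hQ in
/-- The profile `eP ∘ r + eP + w` is `e⁺` (keep the layers `0 ≤ x₀ ≤ S`, reflect elsewhere). -/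
theorem tiltSchwarzTemporal_profile_plus (x : Site 4 (2 * S + 1)) :
    eP (WilsonRP.plaqReflect (x, o)).1 + eP x + w x =
      if (x 0 - (0 : ZMod (2 * S + 1))).val ≤ S then e x
      else e (Function.update x 0 (2 * (0 : ZMod (2 * S + 1)) - x 0)) := by
  rw [tiltSchwarzTemporal_eP_reflect o ho e eP hP, hP x, hw x, sub_zero,
    tiltSchwarzTemporal_update_eq]
  rcases tiltSchwarzTemporal_layers x with ⟨h0, hy0⟩ | ⟨ha1, ha2, hy1, -⟩ | ⟨ha, hb, hy1, hy2⟩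
  · have ha : ¬(1 ≤ (x 0).val ∧ (x 0).val ≤ S) := by omega
    have hya : ¬(1 ≤ ((x.shift 0).timeReflect 0).val ∧ ((x.shift 0).timeReflect 0).val ≤ S) := by
      omega
    have hc : (x 0).val ≤ S := by omega
    rw [if_neg hya, if_neg ha, if_pos h0, if_pos hc, zero_add, zero_add]
  · have hb : (x 0).val ≠ 0 := by omega
    rw [if_neg hy1, if_pos ⟨ha1, ha2⟩, if_neg hb, if_pos ha2, zero_add, add_zero]
  · have hc : ¬((x 0).val ≤ S) := by omega
    rw [if_pos ⟨hy1, hy2⟩, if_neg ha, if_neg hb, if_neg hc, add_zero, add_zero]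

omit hP in
/-- The profile `eQ ∘ r + eQ + w` is `e⁻` (keep the layers `x₀ ∈ {0} ∪ [S + 1, 2S]`, reflect
elsewhere). -/
theorem tiltSchwarzTemporal_profile_minus (x : Site 4 (2 * S + 1)) :
    eQ (WilsonRP.plaqReflect (x, o)).1 + eQ x + w x =
      if ((0 : ZMod (2 * S + 1)) - x 0).val ≤ S then e x
      else e (Function.update x 0 (2 * (0 : ZMod (2 * S + 1)) - x 0)) := by
  rw [tiltSchwarzTemporal_eQ_reflect o ho e eQ hQ, hQ x, hw x, tiltSchwarzTemporal_update_eq,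
    tiltSchwarzTemporal_zero_sub]
  rcases tiltSchwarzTemporal_layers x with ⟨h0, hy0⟩ | ⟨ha1, ha2, hy1, hy2⟩ | ⟨ha, hb, hy1, hy2⟩
  · have ha : ¬(1 ≤ (x 0).val ∧ (x 0).val ≤ S) := by omega
    have hya : ¬(1 ≤ ((x.shift 0).timeReflect 0).val ∧ ((x.shift 0).timeReflect 0).val ≤ S) := by
      omega
    have hc : ((x.shift 0).timeReflect 0).val ≤ S := by omega
    rw [if_neg hya, if_neg ha, if_pos h0, if_pos hc, zero_add, zero_add]
  · have hb : (x 0).val ≠ 0 := by omega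
    have hc : ¬(((x.shift 0).timeReflect 0).val ≤ S) := by omega
    rw [if_neg hy1, if_pos ⟨ha1, ha2⟩, if_neg hb, if_neg hc, zero_add, add_zero]
  · rw [if_pos ⟨hy1, hy2⟩, if_neg ha, if_neg hb, if_pos hy2, add_zero, add_zero]

end Profiles

/-! ## The stub -/

/-- **Stub (SCHWARZ-TEMPORAL).** Reflection Schwarz inequality in direction `0` for the tilt
functionals `Ψ(c) = E_β exp(-∑ₓ c(x) Re tr ρ(U_{(x,o)}))` of a temporal orientation class `o`
(`o.1.1 = 0`) on the odd torus `(ℤ/(2S+1))⁴`, `S ≥ 1`, and a profile `0 ≤ e ≤ β`: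
`Ψ(e)² ≤ Ψ(e⁻) Ψ(e⁺)` for the reflection `x₀ ↦ 2 ⬝ 0 - x₀ = -x₀` of base layers about the
crossing layer `0`, `e⁻` keeping the layers with `(0 - x₀).val ≤ S` and `e⁺` those with
`(x₀ - 0).val ≤ S` (the tilt of the crossing layer is carried by the crossing weight). -/
theorem stub_tiltSchwarz_temporal : ∀ (S N : ℕ) (G : Type) [Group G] [TopologicalSpace G] [IsTopologicalGroup G] [CompactSpace G] [MeasurableSpace G] [BorelSpace G] (ρ : G →* Matrix (Fin N) (Fin N) ℂ), 1 ≤ S → Continuous ρ → ∀ (β : ℝ), 0 ≤ β → ∀ (o : {q : Fin 4 × Fin 4 // q.1 < q.2}), o.1.1 = 0 → ∀ (e : Literature.MathematicalPhysics.QuantumFieldTheory.Site 4 (2 * S + 1) → ℝ), (∀ x, 0 ≤ e x) → (∀ x, e x ≤ β) → (∫ U, Real.exp (-∑ x : Literature.MathematicalPhysics.QuantumFieldTheory.Site 4 (2 * S + 1), e x * Literature.MathematicalPhysics.QuantumFieldTheory.WilsonRP.plaqRe ρ U (x, o)) ∂(Literature.MathematicalPhysics.QuantumFieldTheory.wilsonMeasure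 ρ β : MeasureTheory.Measure (Literature.MathematicalPhysics.QuantumFieldTheory.GaugeConfig 4 (2 * S + 1) G))) ^ 2 ≤ (∫ U, Real.exp (-∑ x : Literature.MathematicalPhysics.QuantumFieldTheory.Site 4 (2 * S + 1), (if ((0 : ZMod (2 * S + 1)) - x 0).val ≤ S then e x else e (Function.update x 0 (2 * (0 : ZMod (2 * S + 1)) - x 0))) * Literature.MathematicalPhysics.QuantumFieldTheory.WilsonRP.plaqRe ρ U (x, o)) ∂(Literature.MathematicalPhysics.QuantumFieldTheory.wilsonMeasure ρ β : MeasureTheory.Measure (Literature.MathematicalPhysics.QuantumFieldTheory.GaugeConfig 4 (2 * S + 1) G))) * (∫ U, Real.exp (-∑ x : Literature.MathematicalPhysics.QuantumFieldTheory.Site 4 (2 * S + 1), (if (x 0 - (0 : ZMod (2 * S + 1))).val ≤ S then e x else e (Function.update x 0 (2 * (0 : ZMod (2 * S + 1)) - x 0))) * Literature.MathematicalPhysics.QuantumFieldTheory.WilsonRP.plaqRe ρ U (x, o)) ∂(Literature.MathematicalPhysics.QuantumFieldTheory.wilsonMeasure ρ β : MeasureTheory.Measure (Literature.MathematicalPhysics.QuantumFieldTheory.GaugeConfig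 4 (2 * S + 1) G))) := by
  intro S N G _ _ _ _ _ _ ρ hS hρ β hβ o ho e he0 heβ
  -- the half profiles `eP`, `eQ` and the crossing profile `w`, kept opaque
  obtain ⟨eP, hP⟩ : ∃ eP : Site 4 (2 * S + 1) → ℝ, ∀ x : Site 4 (2 * S + 1), eP x =
      if 1 ≤ (x 0).val ∧ (x 0).val ≤ S then e x else 0 :=
    ⟨_, fun _ => rfl⟩
  obtain ⟨eQ, hQ⟩ : ∃ eQ : Site 4 (2 * S + 1) → ℝ, ∀ x : Site 4 (2 * S + 1), eQ x =
      if 1 ≤ (x 0).val ∧ (x 0).val ≤ S then e (x.shift 0).timeReflect else 0 :=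
    ⟨_, fun _ => rfl⟩
  obtain ⟨w, hw⟩ : ∃ w : Site 4 (2 * S + 1) → ℝ, ∀ x : Site 4 (2 * S + 1), w x =
      if (x 0).val = 0 then e x else 0 :=
    ⟨_, fun _ => rfl⟩
  have hw0 : ∀ x, 0 ≤ w x := fun x => by
    rw [hw x]
    split_ifs
    exacts [he0 x, le_rfl]
  have hwβ : ∀ x, w x ≤ β := fun x => by
    rw [hw x]
    split_ifs
    exacts [heβ x, hβ]
  -- the reflection Schwarz inequality of crux `LatticeGapOnTrajectory` from the landed (A)
  have key := schwarz_profiles ρ o stub_oddRPCrossTilt hS hρ hβ eP eQ w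
    (tiltSchwarzTemporal_support o eP e hP)
    (tiltSchwarzTemporal_support o eQ (fun x => e (x.shift 0).timeReflect) hQ)
    (tiltSchwarzTemporal_support_cross o ho e w hw) hw0 hwβ
  -- the mixed profile `eQ ∘ r + eP + w` is `e` (layer bookkeeping on the odd cycle)
  have hmixed : ∀ x : Site 4 (2 * S + 1), eQ (WilsonRP.plaqReflect (x, o)).1 + eP x + w x = e x := by
    intro x
    rw [tiltSchwarzTemporal_eQ_reflect o ho e eQ hQ, hP x, hw x]
    rcases tiltSchwarzTemporal_layers x with ⟨h0, hy0⟩ | ⟨ha1, ha2, hy1, -⟩ | ⟨ha, hb, hy1, hy2⟩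
    · have ha : ¬(1 ≤ (x 0).val ∧ (x 0).val ≤ S) := by omega
      have hya : ¬(1 ≤ ((x.shift 0).timeReflect 0).val ∧ ((x.shift 0).timeReflect 0).val ≤ S) := by
        omega
      rw [if_neg hya, if_neg ha, if_pos h0, zero_add, zero_add]
    · have hb : (x 0).val ≠ 0 := by omega
      rw [if_neg hy1, if_pos ⟨ha1, ha2⟩, if_neg hb, zero_add, add_zero]
    · rw [if_pos ⟨hy1, hy2⟩, if_neg ha, if_neg hb, add_zero, add_zero]
  simp only [hmixed, tiltSchwarzTemporal_profile_plus o ho e eP w hP hw,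
    tiltSchwarzTemporal_profile_minus o ho e eQ w hQ hw] at key
  exact key.trans_eq (mul_comm _ _)

end Summit.QuantumFields.YangMills.Theorems.NonSimplyConnectedLatticeGap
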